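import Literature.Analysis.OperatorTheory.RieszProjectionIdempotent
import Mathlib.Analysis.SpecificLimits.Normed
import HarnessLib

/-!
# Riesz projection over a circle centred at the origin: forward decay on the range, backward
  decay on the kernel (exponential dichotomy), and `P = 1` when the circle encloses the spectrum

Analysis/OperatorTheory proofs-layer file (theorems only, no definitions, no named facts),
continuing `RieszProjectionContour.lean` / `RieszProjectionIdempotent.lean`. For an element `a`
of a complex Banach algebra and a circle `|z| = r` in `ρ(a)` with Riesz projection
`P_r = (2πi)⁻¹ ∮_{|z|=r} (z − a)⁻¹ dz` (Kato 1966, III-§6.4 (6.19)) we prove the two "half"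
functional-calculus identities that give the **exponential dichotomy** of `a` relative to the
circle without developing `σ(a|PX)`:

* `pow_mul_circleIntegral_resolvent`: `aⁿ ∮ R = ∮ zⁿ R(z) dz` (from `a R(z) = z R(z) − 1` and
  `∮ zⁿ dz = 0`), whence **`‖aⁿ P_r‖ ≤ (r M) rⁿ`** with `M = sup_{|z|=r} ‖R(z)‖`
  (`norm_pow_mul_rieszProjection_le`): forward iterates decay like `rⁿ` on `P_r X`;
* `exists_backward_family`: for two circles `r ≤ ρ` in `ρ(a)` the elements
  `J n = (2πi)⁻¹ (∮_{|z|=ρ} − ∮_{|z|=r}) z⁻ⁿ R(z) dz` satisfy `J 0 = P_ρ − P_r`,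
  **`a · J (n+1) = J n`** (the residues of `z^{-(n+1)}` over the two circles cancel) and
  **`‖J n‖ rⁿ ≤ C`**: on `(P_ρ − P_r) X` one can go backwards `n` steps at cost `C r⁻ⁿ`;
* `exists_rieszProjection_eq_one`: `P_ρ = 1` for all large `ρ` (`‖P_ρ − 1‖ = ‖(2πi)⁻¹∮ z⁻¹ a R‖
  is small and `P_ρ` is an idempotent, hence an invertible idempotent);
* `rieszProjection_eq_one_of_norm_pow_le`: if `‖sⁿ‖ ≤ C θⁿ` and `θ < r` then `P_r(s) = 1`
  (`1 − P_r = sⁿ J n` has norm `≤ C C' (θ/r)ⁿ → 0`);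
* `resolvent_sub_resolvent_eq_mul`: the second resolvent identity
  `R_m(z) − R_s(z) = R_m(z) (m − s) R_s(z)`.

With `r < 1 <`-free choices these are exactly the linear estimates consumed by the Lyapunov–Perron
construction of pseudo-(un)stable manifolds of a map with quasi-compact derivative.

## References

* T. Kato, *Perturbation Theory for Linear Operators*, Springer 1966, III-§6.4, Thm. 6.17,
  (6.19)–(6.23); I-§5.6 (holomorphic functional calculus). [Kato1966]
-/

noncomputable section

open _root_.Complex _root_.MeasureTheory _root_.Metric _root_.Set _root_.Filter _root_.Topology
open _root_.Bornology

namespace Literature.Analysis.OperatorTheory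

section Algebra

variable {A : Type*} [NormedRing A] [NormedAlgebra ℂ A] [CompleteSpace A]

omit [CompleteSpace A] in
/-- `a R(z) = z R(z) − 1` for `z ∈ ρ(a)` (multiply out `(z − a) R(z) = 1`). [folklore] -/
theorem mul_resolvent_eq_smul_sub_one {a : A} {z : ℂ} (hz : z ∈ resolventSet ℂ a) :
    a * resolvent a z = z • resolvent a z - 1 := by
  have h1 : (algebraMap ℂ A z - a) * resolvent a z = 1 := Ring.mul_inverse_cancel _ hz
  rw [Algebra.algebraMap_eq_smul_one, sub_mul, smul_mul_assoc, one_mul] at h1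
  rw [← h1]; abel

omit [CompleteSpace A] in
/-- **Second resolvent identity**: `R_m(z) − R_s(z) = R_m(z) (m − s) R_s(z)` for
`z ∈ ρ(m) ∩ ρ(s)` (Kato 1966, II-(1.11)/IV-§3.1). [cite: Kato1966, I-§5.2 (5.5)] -/
theorem resolvent_sub_resolvent_eq_mul {m s : A} {z : ℂ} (hm : z ∈ resolventSet ℂ m)
    (hs : z ∈ resolventSet ℂ s) :
    resolvent m z - resolvent s z = resolvent m z * (m - s) * resolvent s z := by
  have h1 : resolvent m z * (algebraMap ℂ A z - m) = 1 := Ring.inverse_mul_cancel _ hm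
  have h2 : (algebraMap ℂ A z - s) * resolvent s z = 1 := Ring.mul_inverse_cancel _ hs
  have key : resolvent m z * ((algebraMap ℂ A z - s) - (algebraMap ℂ A z - m)) * resolvent s z =
      resolvent m z - resolvent s z := by
    rw [mul_sub, sub_mul, mul_assoc (resolvent m z) (algebraMap ℂ A z - s), h2, mul_one, h1,
      one_mul]
  rw [← key, sub_sub_sub_cancel_left]

/-- A uniform bound for the resolvent on a circle contained in the resolvent set (continuity on a
compact set). [folklore] -/
theorem exists_norm_resolvent_le_of_sphere_subset {a : A} {c : ℂ} {r : ℝ}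
    (hs : sphere c r ⊆ resolventSet ℂ a) :
    ∃ M : ℝ, 0 ≤ M ∧ ∀ z ∈ sphere c r, ‖resolvent a z‖ ≤ M := by
  obtain ⟨M, hM⟩ := (isCompact_sphere c r).exists_bound_of_continuousOn
    ((continuousOn_resolvent a).mono hs)
  exact ⟨max M 0, le_max_right _ _, fun z hz => (hM z hz).trans (le_max_left _ _)⟩

/-- Left multiplication commutes with the circle integral. [folklore] -/
theorem mul_circleIntegral {f : ℂ → A} {c : ℂ} {R : ℝ} (hf : CircleIntegrable f c R) (a : A) :
    a * (∮ z in C(c, R), f z) = ∮ z in C(c, R), a * f z := by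
  have hl := (ContinuousLinearMap.mul ℂ A a).intervalIntegral_comp_comm ((circleIntegrable_iff R).1 hf)
  simp only [ContinuousLinearMap.mul_apply', mul_smul_comm] at hl
  simp only [circleIntegral]
  exact hl.symm

/-- `∮_{|z|=ρ} z^{-(n+1)} dz = ∮_{|z|=r} z^{-(n+1)} dz` for two circles around the origin (both
vanish for `n ≠ 0`, both equal `2πi` for `n = 0`). [folklore] -/
theorem circleIntegral_inv_pow_succ_eq {r ρ : ℝ} (hr : 0 < r) (hρ : 0 < ρ) (n : ℕ) :
    (∮ z in C(0, ρ), (z ^ (n + 1))⁻¹) = ∮ z in C(0, r), (z ^ (n + 1))⁻¹ := by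
  rcases Nat.eq_zero_or_pos n with rfl | hn
  · simp only [zero_add, pow_one]
    have h1 := circleIntegral.integral_sub_center_inv (0 : ℂ) hρ.ne'
    have h2 := circleIntegral.integral_sub_center_inv (0 : ℂ) hr.ne'
    simp only [sub_zero] at h1 h2
    rw [h1, h2]
  · have hfun : (fun z : ℂ => (z ^ (n + 1))⁻¹) = fun z => (z - 0) ^ (-((n + 1 : ℕ) : ℤ)) := by
      funext z; rw [sub_zero, zpow_neg, zpow_natCast]
    have hz : ∀ R : ℝ, (∮ z in C(0, R), (z ^ (n + 1))⁻¹) = 0 := fun R => by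
      rw [hfun]
      exact circleIntegral.integral_sub_zpow_of_ne (by push_cast; omega) 0 0 R
    rw [hz, hz]

/-! ### Forward estimate: `aⁿ P = (2πi)⁻¹ ∮ zⁿ R(z) dz` -/

/-- **`aⁿ ∮ R(z) dz = ∮ zⁿ R(z) dz`** over a circle around the origin in the resolvent set
(induction on `n` with `a R(z) = z R(z) − 1` and `∮ zⁿ dz = 0`; this is the functional
calculus identity `aⁿ P = (zⁿ·𝟙_{inside})(a)`, Kato I-§5.6 / III-(6.23)).
[cite: Kato1966, III-§6.4 Thm. 6.17 (6.19)] -/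
theorem pow_mul_circleIntegral_resolvent {a : A} {r : ℝ} (hr : 0 < r)
    (hs : sphere 0 r ⊆ resolventSet ℂ a) (n : ℕ) :
    a ^ n * (∮ z in C(0, r), resolvent a z) = ∮ z in C(0, r), z ^ n • resolvent a z := by
  have hRc : ContinuousOn (fun z : ℂ => resolvent a z) (sphere 0 r) :=
    (continuousOn_resolvent a).mono hs
  induction n with
  | zero => simp
  | succ n ih =>
    have hci : CircleIntegrable (fun z : ℂ => z ^ n • resolvent a z) 0 r :=
      ((continuousOn_pow n).smul hRc).circleIntegrable hr.le
    have hci' : CircleIntegrable (fun z : ℂ => z ^ (n + 1) • resolvent a z) 0 r :=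
      ((continuousOn_pow (n + 1)).smul hRc).circleIntegrable hr.le
    have hci1 : CircleIntegrable (fun z : ℂ => z ^ n • (1 : A)) 0 r :=
      ((continuousOn_pow n).smul continuousOn_const).circleIntegrable hr.le
    rw [pow_succ', mul_assoc, ih, mul_circleIntegral hci]
    have heq : EqOn (fun z : ℂ => a * (z ^ n • resolvent a z))
        (fun z => z ^ (n + 1) • resolvent a z - z ^ n • (1 : A)) (sphere 0 r) := fun z hz => by
      simp only
      rw [mul_smul_comm, mul_resolvent_eq_smul_sub_one (hs hz), smul_sub, smul_smul, pow_succ]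
    rw [circleIntegral.integral_congr hr.le heq, circleIntegral.integral_sub hci' hci1,
      circleIntegral.integral_smul_const]
    have h0 : (∮ z in C(0, r), z ^ n) = 0 := by
      have h := circleIntegral.integral_sub_zpow_of_ne (n := (n : ℤ)) (by omega) (0 : ℂ) 0 r
      simpa using h
    rw [h0, zero_smul, sub_zero]

/-- **Forward dichotomy estimate**: if `|z| = r > 0` lies in `ρ(a)` and `‖R(z)‖ ≤ M` there, then
`‖aⁿ P_r‖ ≤ (r M) rⁿ` for all `n` — the iterates of `a` decay at rate `r` on the range of the
Riesz projection. [cite: Kato1966, III-§6.4 Thm. 6.17 (6.19)] -/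
theorem norm_pow_mul_rieszProjection_le {a : A} {r M : ℝ} (hr : 0 < r)
    (hs : sphere 0 r ⊆ resolventSet ℂ a) (hM : ∀ z ∈ sphere (0 : ℂ) r, ‖resolvent a z‖ ≤ M)
    (n : ℕ) :
    ‖a ^ n * rieszProjection a 0 r‖ ≤ r * M * r ^ n := by
  rw [rieszProjection_def, mul_smul_comm, pow_mul_circleIntegral_resolvent hr hs n]
  have hb : ∀ z ∈ sphere (0 : ℂ) r, ‖z ^ n • resolvent a z‖ ≤ r ^ n * M := fun z hz => by
    rw [norm_smul, norm_pow, mem_sphere_zero_iff_norm.1 hz]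
    exact mul_le_mul_of_nonneg_left (hM z hz) (pow_nonneg hr.le n)
  calc ‖(2 * Real.pi * I : ℂ)⁻¹ • ∮ z in C(0, r), z ^ n • resolvent a z‖ ≤ r * (r ^ n * M) :=
        circleIntegral.norm_two_pi_i_inv_smul_integral_le_of_norm_le_const hr.le hb
    _ = r * M * r ^ n := by ring

/-! ### Backward estimate: the family `J n = (2πi)⁻¹ (∮_ρ − ∮_r) z⁻ⁿ R(z) dz` -/

/-- **Backward dichotomy family.** For two circles `0 < r ≤ ρ` around the origin in `ρ(a)` there
are elements `J n` (`n ≥ 0`) with `J 0 = P_ρ − P_r`, `a · J (n+1) = J n` and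
`‖J n‖ rⁿ ≤ C`: on the spectral subspace of the annulus one can iterate backwards at rate `r⁻¹`.
(`J n = (2πi)⁻¹ (∮_{|z|=ρ} − ∮_{|z|=r}) z⁻ⁿ R(z) dz`; the relation uses `a R = z R − 1` and the
cancellation of `∮ z^{-(n+1)} dz` between the two circles.) [cite: Kato1966, III-§6.4 Thm. 6.17 (6.19)–(6.23)] -/
theorem exists_backward_family {a : A} {r ρ : ℝ} (hr : 0 < r) (hrρ : r ≤ ρ)
    (hs : sphere 0 r ⊆ resolventSet ℂ a) (hs' : sphere 0 ρ ⊆ resolventSet ℂ a) :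
    ∃ (J : ℕ → A) (C : ℝ), J 0 = rieszProjection a 0 ρ - rieszProjection a 0 r ∧
      (∀ n, a * J (n + 1) = J n) ∧ (∀ n, ‖J n‖ * r ^ n ≤ C) := by
  have hρ : 0 < ρ := hr.trans_le hrρ
  obtain ⟨M, hM0, hM⟩ := exists_norm_resolvent_le_of_sphere_subset hs
  obtain ⟨M', hM0', hM'⟩ := exists_norm_resolvent_le_of_sphere_subset hs'
  -- the integrals `I R n = ∮_{|z|=R} (zⁿ)⁻¹ R(z) dz`
  set I' : ℝ → ℕ → A := fun R n => ∮ z in C(0, R), (z ^ n)⁻¹ • resolvent a z with hI'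
  refine ⟨fun n => (2 * Real.pi * I : ℂ)⁻¹ • (I' ρ n - I' r n), ρ * M' + r * M, ?_, ?_, ?_⟩
  · -- `J 0 = P_ρ − P_r`
    simp only [hI', pow_zero, inv_one, one_smul, rieszProjection_def, smul_sub]
  · -- `a J (n+1) = J n`
    intro n
    -- the computation on one circle
    have key : ∀ {R : ℝ}, 0 < R → sphere 0 R ⊆ resolventSet ℂ a →
        a * I' R (n + 1) = I' R n - (∮ z in C(0, R), (z ^ (n + 1))⁻¹) • (1 : A) := by
      intro R hR hsR
      have hRc : ContinuousOn (fun z : ℂ => resolvent a z) (sphere 0 R) :=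
        (continuousOn_resolvent a).mono hsR
      have h0 : ∀ z ∈ sphere (0 : ℂ) R, z ≠ 0 := fun z hz => by
        rw [← norm_pos_iff, mem_sphere_zero_iff_norm.1 hz]; exact hR
      have hinv : ∀ k : ℕ, ContinuousOn (fun z : ℂ => (z ^ k)⁻¹) (sphere 0 R) := fun k z hz =>
        ((continuousAt_id.pow k).inv₀ (pow_ne_zero k (h0 z hz))).continuousWithinAt
      have hci : CircleIntegrable (fun z : ℂ => (z ^ (n + 1))⁻¹ • resolvent a z) 0 R :=
        ((hinv (n + 1)).smul hRc).circleIntegrable hR.le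
      have hci' : CircleIntegrable (fun z : ℂ => (z ^ n)⁻¹ • resolvent a z) 0 R :=
        ((hinv n).smul hRc).circleIntegrable hR.le
      have hci1 : CircleIntegrable (fun z : ℂ => (z ^ (n + 1))⁻¹ • (1 : A)) 0 R :=
        ((hinv (n + 1)).smul continuousOn_const).circleIntegrable hR.le
      have heq : EqOn (fun z : ℂ => a * ((z ^ (n + 1))⁻¹ • resolvent a z))
          (fun z => (z ^ n)⁻¹ • resolvent a z - (z ^ (n + 1))⁻¹ • (1 : A)) (sphere 0 R) := by
        intro z hz
        simp only
        rw [mul_smul_comm, mul_resolvent_eq_smul_sub_one (hsR hz), smul_sub, smul_smul]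
        congr 2
        rw [pow_succ, mul_inv, inv_mul_cancel_right₀ (h0 z hz)]
      change a * (∮ z in C(0, R), (z ^ (n + 1))⁻¹ • resolvent a z) =
        (∮ z in C(0, R), (z ^ n)⁻¹ • resolvent a z) - _
      rw [mul_circleIntegral hci, circleIntegral.integral_congr hR.le heq,
        circleIntegral.integral_sub hci' hci1, circleIntegral.integral_smul_const]
    rw [mul_smul_comm, mul_sub, key hρ hs', key hr hs, circleIntegral_inv_pow_succ_eq hr hρ n]
    congr 1
    abel
  · -- the bound
    intro n
    have hb : ∀ {R M₀ : ℝ}, 0 < R → (∀ z ∈ sphere (0 : ℂ) R, ‖resolvent a z‖ ≤ M₀) →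
        ‖(2 * Real.pi * I : ℂ)⁻¹ • I' R n‖ ≤ R * ((R ^ n)⁻¹ * M₀) := by
      intro R M₀ hR hMR
      refine circleIntegral.norm_two_pi_i_inv_smul_integral_le_of_norm_le_const hR.le
        fun z hz => ?_
      rw [norm_smul, norm_inv, norm_pow, mem_sphere_zero_iff_norm.1 hz]
      exact mul_le_mul_of_nonneg_left (hMR z hz) (by positivity)
    have h1 := hb hρ hM'
    have h2 := hb hr hM
    have hrn : 0 < r ^ n := pow_pos hr n
    have hρn : 0 < ρ ^ n := pow_pos hρ n
    calc ‖(2 * Real.pi * I : ℂ)⁻¹ • (I' ρ n - I' r n)‖ * r ^ n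
        ≤ (ρ * ((ρ ^ n)⁻¹ * M') + r * ((r ^ n)⁻¹ * M)) * r ^ n := by
          rw [smul_sub]
          exact mul_le_mul_of_nonneg_right ((norm_sub_le _ _).trans (add_le_add h1 h2)) hrn.le
      _ = ρ * M' * (r ^ n / ρ ^ n) + r * M := by field_simp
      _ ≤ ρ * M' * 1 + r * M := by
          gcongr
          rw [div_le_one hρn]
          exact pow_le_pow_left₀ hr.le hrρ n
      _ = ρ * M' + r * M := by ring

/-! ### `P = 1` when the circle encloses the spectrum -/

/-- **The Riesz projection over a large circle is the identity**: there is `ρ₀ > 0` such that for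
every `ρ ≥ ρ₀` the circle `|z| = ρ` lies in `ρ(a)` and `P_ρ = 1`. (By
`R(z) − z⁻¹ = z⁻¹ a R(z)` and `R(z) → 0` at infinity, `‖P_ρ − 1‖ ≤ ‖a‖ sup ‖R‖ < 1` for large
`ρ`; an idempotent within distance `< 1` of `1` is invertible, hence equals `1`. Kato III-(6.19)
with `Γ` enclosing all of `Σ(T)`.) [cite: Kato1966, III-§6.4 Thm. 6.17 (6.19)] -/
theorem exists_rieszProjection_eq_one (a : A) :
    ∃ ρ₀ : ℝ, 0 < ρ₀ ∧ ∀ ρ, ρ₀ ≤ ρ →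
      sphere (0 : ℂ) ρ ⊆ resolventSet ℂ a ∧ rieszProjection a 0 ρ = 1 := by
  -- `‖R(z)‖ < ε` for `|z| > R₀`
  set ε : ℝ := 1 / (2 * (‖a‖ + 1)) with hε
  have hε0 : 0 < ε := by positivity
  have ht := spectrum.resolvent_tendsto_cobounded (𝕜 := ℂ) a
  obtain ⟨R₀, -, hR₀⟩ := ((hasBasis_cobounded_compl_closedBall (0 : ℂ)).tendsto_left_iff.1 ht)
    (ball 0 ε) (ball_mem_nhds 0 hε0)
  refine ⟨max (R₀ + 1) (‖a‖ * ‖(1 : A)‖ + 1), lt_max_of_lt_right (by positivity), fun ρ hρ => ?_⟩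
  have hρ0 : 0 < ρ := lt_of_lt_of_le (by positivity) ((le_max_right _ _).trans hρ)
  have hsphere : sphere (0 : ℂ) ρ ⊆ resolventSet ℂ a := fun z hz =>
    spectrum.mem_resolventSet_of_norm_lt_mul (by
      rw [mem_sphere_zero_iff_norm.1 hz]; linarith [le_max_right (R₀ + 1) (‖a‖ * ‖(1 : A)‖ + 1)])
  have hRz : ∀ z ∈ sphere (0 : ℂ) ρ, ‖resolvent a z‖ < ε := fun z hz => by
    have h := hR₀ (show z ∈ (closedBall (0 : ℂ) R₀)ᶜ by
      rw [mem_compl_iff, mem_closedBall, dist_zero_right, mem_sphere_zero_iff_norm.1 hz, not_le]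
      linarith [le_max_left (R₀ + 1) (‖a‖ * ‖(1 : A)‖ + 1)])
    simpa using h
  refine ⟨hsphere, ?_⟩
  set P := rieszProjection a 0 ρ with hP
  -- `‖P − 1‖ ≤ ‖a‖ ε < 1`
  have hRc : ContinuousOn (fun z : ℂ => resolvent a z) (sphere 0 ρ) :=
    (continuousOn_resolvent a).mono hsphere
  have h0 : ∀ z ∈ sphere (0 : ℂ) ρ, z ≠ 0 := fun z hz => by
    rw [← norm_pos_iff, mem_sphere_zero_iff_norm.1 hz]; exact hρ0
  have hinv : ContinuousOn (fun z : ℂ => z⁻¹) (sphere 0 ρ) := fun z hz =>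
    (continuousAt_inv₀ (h0 z hz)).continuousWithinAt
  have hone : (2 * Real.pi * I : ℂ)⁻¹ • (∮ z in C(0, ρ), z⁻¹ • (1 : A)) = 1 := by
    rw [circleIntegral.integral_smul_const]
    have h := circleIntegral.integral_sub_center_inv (0 : ℂ) hρ0.ne'
    simp only [sub_zero] at h
    rw [h, smul_smul, inv_mul_cancel₀ (by simp [Real.pi_ne_zero, I_ne_zero]), one_smul]
  have hciR : CircleIntegrable (fun z : ℂ => resolvent a z) 0 ρ := hRc.circleIntegrable hρ0.le
  have hci1 : CircleIntegrable (fun z : ℂ => z⁻¹ • (1 : A)) 0 ρ :=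
    (hinv.smul continuousOn_const).circleIntegrable hρ0.le
  have hdiff : P - 1 = (2 * Real.pi * I : ℂ)⁻¹ • ∮ z in C(0, ρ), z⁻¹ • (a * resolvent a z) := by
    rw [← hone, hP, rieszProjection_def, ← smul_sub, ← circleIntegral.integral_sub hciR hci1]
    congr 1
    refine circleIntegral.integral_congr hρ0.le fun z hz => ?_
    change resolvent a z - z⁻¹ • (1 : A) = z⁻¹ • (a * resolvent a z)
    rw [mul_resolvent_eq_smul_sub_one (hsphere hz), smul_sub, smul_smul,
      inv_mul_cancel₀ (h0 z hz), one_smul]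
  have hnorm : ‖P - 1‖ ≤ 1 / 2 := by
    rw [hdiff]
    have hb : ∀ z ∈ sphere (0 : ℂ) ρ, ‖z⁻¹ • (a * resolvent a z)‖ ≤ ρ⁻¹ * (‖a‖ * ε) := by
      intro z hz
      rw [norm_smul, norm_inv, mem_sphere_zero_iff_norm.1 hz]
      exact mul_le_mul_of_nonneg_left ((norm_mul_le _ _).trans
        (mul_le_mul_of_nonneg_left (hRz z hz).le (norm_nonneg _))) (by positivity)
    calc ‖(2 * Real.pi * I : ℂ)⁻¹ • ∮ z in C(0, ρ), z⁻¹ • (a * resolvent a z)‖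
        ≤ ρ * (ρ⁻¹ * (‖a‖ * ε)) :=
          circleIntegral.norm_two_pi_i_inv_smul_integral_le_of_norm_le_const hρ0.le hb
      _ = ‖a‖ * ε := by field_simp
      _ ≤ (‖a‖ + 1) * ε := by gcongr; linarith
      _ = 1 / 2 := by rw [hε]; field_simp
  -- an idempotent with `‖1 − P‖ < 1` is `1`
  have hlt : ‖1 - P‖ < 1 := by rw [norm_sub_rev]; linarith
  have hidem : P * P = P := rieszProjection_mul_self hρ0 hsphere
  set u := Units.oneSub (1 - P) hlt with hu
  have huP : (u : A) = P := by rw [hu, Units.val_oneSub, sub_sub_cancel]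
  rw [← huP] at hidem ⊢
  exact (Units.mul_right_inj u).1 (by rw [hidem, mul_one])

omit [NormedAlgebra ℂ A] [CompleteSpace A] in
/-- `aⁿ J n = J 0` for a backward family. [folklore] -/
theorem pow_mul_backward_family {a : A} {J : ℕ → A} (hJ : ∀ n, a * J (n + 1) = J n) (n : ℕ) :
    a ^ n * J n = J 0 := by
  induction n with
  | zero => simp
  | succ n ih => rw [pow_succ, mul_assoc, hJ n, ih]

/-- **`P_r(s) = 1` for a power-dominated element**: if `‖sⁿ‖ ≤ C θⁿ` for all `n`, `θ < r`, and
every `z` with `|z| > θ` lies in `ρ(s)`, then the Riesz projection of `s` over `|z| = r` is the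
identity (`1 − P_r = P_ρ − P_r = sⁿ J n` for a large circle `ρ`, and
`‖sⁿ‖ ‖J n‖ ≤ C C' (θ / r)ⁿ → 0`). [cite: Kato1966, III-§6.4 Thm. 6.17 (6.19)] -/
theorem rieszProjection_eq_one_of_norm_pow_le {s : A} {C θ r : ℝ} (hθ : 0 ≤ θ)
    (hs : ∀ n : ℕ, ‖s ^ n‖ ≤ C * θ ^ n) (hr : θ < r)
    (hρs : ∀ z : ℂ, θ < ‖z‖ → z ∈ resolventSet ℂ s) : rieszProjection s 0 r = 1 := by
  have hr0 : 0 < r := hθ.trans_lt hr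
  obtain ⟨ρ₀, hρ₀, hρ⟩ := exists_rieszProjection_eq_one s
  set ρ := max ρ₀ r with hρdef
  obtain ⟨hsρ, hPρ⟩ := hρ ρ (le_max_left _ _)
  have hsr : sphere (0 : ℂ) r ⊆ resolventSet ℂ s := fun z hz =>
    hρs z (by rw [mem_sphere_zero_iff_norm.1 hz]; exact hr)
  obtain ⟨J, C', hJ0, hJ, hJn⟩ := exists_backward_family hr0 (le_max_right _ _) hsr hsρ
  rw [hPρ] at hJ0
  -- `‖1 − P_r‖ ≤ C C' (θ/r)ⁿ` for all `n`
  have hC : 0 ≤ C := by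
    have h0 := hs 0; rw [pow_zero, pow_zero, mul_one] at h0; exact (norm_nonneg _).trans h0
  have hC' : 0 ≤ C' := le_trans (mul_nonneg (norm_nonneg _) (pow_nonneg hr0.le 0)) (hJn 0)
  have hbound : ∀ n : ℕ, ‖1 - rieszProjection s 0 r‖ ≤ C * C' * (θ / r) ^ n := fun n => by
    rw [← hJ0, ← pow_mul_backward_family hJ n]
    have hrn : 0 < r ^ n := pow_pos hr0 n
    calc ‖s ^ n * J n‖ ≤ ‖s ^ n‖ * ‖J n‖ := norm_mul_le _ _
      _ ≤ (C * θ ^ n) * (C' / r ^ n) := by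
          refine mul_le_mul (hs n) ?_ (norm_nonneg _) (le_trans (norm_nonneg _) (hs n))
          rw [le_div_iff₀ hrn]; exact hJn n
      _ = C * C' * (θ / r) ^ n := by rw [div_pow]; field_simp
  have ht : Tendsto (fun n : ℕ => C * C' * (θ / r) ^ n) atTop (𝓝 (C * C' * 0)) :=
    (tendsto_pow_atTop_nhds_zero_of_lt_one (div_nonneg hθ hr0.le)
      ((div_lt_one hr0).2 hr)).const_mul _
  rw [mul_zero] at ht
  have h0 : ‖1 - rieszProjection s 0 r‖ ≤ 0 :=
    ge_of_tendsto' ht fun n => hbound n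
  have : 1 - rieszProjection s 0 r = 0 := norm_le_zero_iff.1 h0
  exact (sub_eq_zero.1 this).symm

end Algebra

end Literature.Analysis.OperatorTheory
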